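import Literature.NumberTheory.EllipticCurves.IwasawaTwistModPTowerExact
import HarnessLib

/-!
# `T^{J−1} = top ∘ const` on `H¹(K, 𝒯_J)`

Glue for the `μ`-transfer core of BSD crux 19276 (HOME/koly/MU-TRANSFER-PROOF.md §5 STEP 1, dual
side: "`T^{e−1}h^* = res(T^{e−1}y_e) ≠ 0` forces `im h^* = 𝒯_e^*`"): on `𝒯_J = M^J` the operator
`S^{J−1}` is the composite of the constant coefficient `𝒯_J → M` and the top-coefficient embedding
`M → 𝒯_J` (`shiftEnd_pow_pred_apply_eq_single`), hence on `H¹`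
(`shiftH1_iterate_pred_eq_map_top_map_const`); so `T^{J−1} c ≠ 0` forces `H¹(const)(c) ≠ 0`
(`map_constCoeff_ne_zero_of_shiftH1_iterate_ne_zero`) — the input of Sah / (F8) for the dual test
class.
-/

noncomputable section

open Field

universe u

namespace Literature.NumberTheory.EllipticCurves.ZpExtension

open Literature.NumberTheory.GaloisRepresentations

variable {K : Type u} [Field K] {p : ℕ} [Fact p.Prime] (κ : ZpExtension K p)
  {M : Type u} [AddCommGroup M] [TopologicalSpace M] [DiscreteTopology M]
  (ρ : DiscreteGaloisModule K M) (hM : ∀ x : M, p • x = 0) {J : ℕ} (hJ : 0 < J)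

omit [TopologicalSpace M] [DiscreteTopology M] in
/-- `S^{J−1} x = x₀ · T^{J−1}`: the `(J−1)`-st power of the shift is "top ∘ const".
[cite: Washington1997, §13.1–§13.2] -/
theorem shiftEnd_pow_pred_apply_eq_single (x : Fin J → M) :
    (shiftEnd M J ^ (J - 1)) x =
      Pi.single (⟨J - 1, Nat.sub_lt hJ Nat.one_pos⟩ : Fin J) (x ⟨0, hJ⟩) := by
  funext i
  rw [shiftEnd_pow_apply, Pi.single_apply]
  by_cases hi : (i : ℕ) < J - 1
  · rw [dif_pos hi, if_neg (fun h => by rw [h] at hi; exact lt_irrefl _ hi)]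
  · rw [dif_neg hi]
    have hi' : i = ⟨J - 1, Nat.sub_lt hJ Nat.one_pos⟩ := Fin.ext (by simp; omega)
    rw [if_pos hi']
    congr 1
    exact Fin.ext (by simp; omega)

/-- **`T^{J−1} = H¹(top) ∘ H¹(const)` on `H¹(K, 𝒯_J)`.** [cite: Washington1997, §13.1–§13.2] -/
theorem shiftH1_iterate_pred_eq_map_top_map_const (c : galoisCohomology (κ.twistModP ρ hM J) 1) :
    (κ.shiftH1 ρ hM J)^[J - 1] c =
      galoisCohomology.map (κ.twistModPTopCoeff ρ hM J hJ) 1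
        (galoisCohomology.map (κ.twistModPConstCoeff ρ hM J hJ) 1 c) := by
  obtain ⟨φ, rfl⟩ := oneCocycleClass_surjective _ c
  rw [shiftH1_iterate_oneCocycleClass, map_oneCocycleClass_twist]
  unfold galoisCohomology.map
  change _ = ContinuousCohomology.map _ _ 1 (oneCocycleClass ρ.toTopRep _)
  rw [map_oneCocycleClass]
  refine congrArg _ (Subtype.ext (ContinuousMap.ext fun σ => ?_))
  change (shiftEnd M J ^ (J - 1)) (φ.1 σ) = κ.twistModPTopCoeff ρ hM J hJ ((φ.1 σ) ⟨0, hJ⟩)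
  rw [shiftEnd_pow_pred_apply_eq_single hJ, twistModPTopCoeff_apply]

/-- **`T^{J−1} c ≠ 0 ⟹ H¹(const)(c) ≠ 0`** (dual side of STEP 1: `T^{e−1} y_e ≠ 0` forces the
constant coefficient class of `y_e` to be non-zero, to which Sah / (F8) applies).
[cite: Washington1997, §13.1–§13.2] [cite: MazurRubin2004, §5.3] -/
theorem map_constCoeff_ne_zero_of_shiftH1_iterate_ne_zero
    (c : galoisCohomology (κ.twistModP ρ hM J) 1) (hc : (κ.shiftH1 ρ hM J)^[J - 1] c ≠ 0) :
    galoisCohomology.map (κ.twistModPConstCoeff ρ hM J hJ) 1 c ≠ 0 := fun h => by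
  rw [shiftH1_iterate_pred_eq_map_top_map_const κ ρ hM hJ, h, map_zero] at hc
  exact hc rfl

end Literature.NumberTheory.EllipticCurves.ZpExtension

end
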